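import Mathlib
import Summits.KontsevichZagierPeriods.Zeta5Search.EulerKernelBasisIntegrals
import HarnessLib

/-!
# The Euler kernel, III: the quadratic basis integrals `B6 = ∫₀¹ E² = 6 − 4ζ(3)`, `B8 = ∫₀¹ uE² = 71/16 − 3ζ(3)`
# by integration by parts (cell `pub-zeta5`, seat ct-1 g21; item (3), first deliverable, part 3)

HONEST FRAMING: systematic search; no irrationality claim unless certified.  Elementary real analysis only, for the
kernel `E(u) = Li₂(u) + log u · log(1 − u)` of `EulerKernelBasisIntegrals` (`Li₂ = reDilog`): the two quadratic
integrals of gen-1 g17 `LEVEL1-EXACT.md` Theorem E ("The squares", `B6 = 2B4`, `B8 = B4 + B4'`) that are NOT of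
depth two.  The human proof integrates by parts through `∫ Eℓ/(1−u) = ζ(2)²/2`; here a shorter route:

* `hasDerivAt_Ek` — `E'(u) = −log u/(1 − u)` on `(0,1)` (the `log(1−u)/u` parts of `Li₂'` and `(log u·log(1−u))'` cancel);
* hence `d/du[(u − 1)E²] = E² − 2ℓE` and `d/du[(u² − 1)E²/2] = uE² − (1 + u)ℓE` (`ℓ = −log u`) EXACTLY, and the
  primitives vanish at both ends of `(0,1)`: `E(u) → 0` as `u → 0⁺` (`tendsto_Ek_zero`) and `E` is bounded,
  `0 ≤ E ≤ π²/6 + 1` (`Ek_le`, from `Li₂ ≤ ζ(2)` and `log u · log(1−u) ≤ 1`), so the FTC on the open interval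
  (`intervalIntegral.integral_eq_sub_of_hasDerivAt_of_tendsto`) gives
  **`integral_Ek_sq_eq : ∫₀¹ E² = 2∫₀¹ ℓE`** and **`integral_mul_Ek_sq_eq : ∫₀¹ uE² = ∫₀¹ ℓE + ∫₀¹ uℓE`**;
* with part 1's `B4 = 3 − 2ζ(3)`, `B4' = 23/16 − ζ(3)`: **`integral_Ek_sq : ∫₀¹ E² = 6 − 4ζ(3)`**,
  **`integral_mul_Ek_sq : ∫₀¹ uE² = 71/16 − 3ζ(3)`**, each with `IntegrableOn … (Ioo 0 1)` (`E²` is bounded and measurable).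

Theorems only; no notation, no definition, no named fact.  Nothing here mentions the cellular integrals or `ζ(5)`.
-/

noncomputable section

open MeasureTheory Set Filter Topology intervalIntegral
open scoped ENNReal Nat

namespace Summit.KontsevichZagierPeriods.Zeta5Search.EulerKernel

open Literature.Analysis.SpecialFunctions (reDilog realDilog reDilog_eq_realDilog continuous_reDilog)
open Literature.NumberTheory.Transcendental (zetaValue)

/-! ## 1. The derivative and the bounds of `E` on `(0,1)` -/

/-- The derivative of the Euler kernel on `(0,1)`: `E'(u) = −log u/(1 − u)` (the `log(1−u)/u` terms of `Li₂'` and of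
`(log u · log(1−u))'` cancel). [folklore] -/
theorem hasDerivAt_Ek {u : ℝ} (h0 : 0 < u) (h1 : u < 1) :
    HasDerivAt (fun u : ℝ => reDilog u + Real.log u * Real.log (1 - u)) (-Real.log u / (1 - u)) u := by
  have hu : u ≠ 0 := h0.ne'
  have hu1 : 1 - u ≠ 0 := by intro h; linarith
  have hA := Literature.Analysis.SpecialFunctions.hasDerivAt_reDilog hu (h1.ne)
  have hB : HasDerivAt (fun u : ℝ => Real.log u * Real.log (1 - u))
      (u⁻¹ * Real.log (1 - u) + Real.log u * (-1 / (1 - u))) u := by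
    have h1' := Real.hasDerivAt_log hu
    have h2' : HasDerivAt (fun u : ℝ => Real.log (1 - u)) (-1 / (1 - u)) u :=
      ((hasDerivAt_id' u).const_sub 1).log hu1
    exact h1'.mul h2'
  refine (hA.add hB).congr_deriv ?_
  field_simp
  ring

/-- Upper bound `log u · log(1 − u) ≤ 1` on `(0,1)` (from `−log u ≤ 1/u − 1`, `−log(1−u) ≤ 1/(1−u) − 1`). [folklore] -/
theorem log_mul_log_one_sub_le_one {u : ℝ} (h0 : 0 < u) (h1 : u < 1) :
    Real.log u * Real.log (1 - u) ≤ 1 := by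
  have hu1 : 0 < 1 - u := by linarith
  have ha : -Real.log u ≤ 1 / u - 1 := by
    have h := Real.log_le_sub_one_of_pos (one_div_pos.2 h0)
    rw [one_div, Real.log_inv] at h
    rw [one_div]; linarith
  have hb : -Real.log (1 - u) ≤ 1 / (1 - u) - 1 := by
    have h := Real.log_le_sub_one_of_pos (one_div_pos.2 hu1)
    rw [one_div, Real.log_inv] at h
    rw [one_div]; linarith
  have ha0 : 0 ≤ -Real.log u := by rw [neg_nonneg]; exact Real.log_nonpos h0.le h1.le
  have hb0 : 0 ≤ -Real.log (1 - u) := by rw [neg_nonneg]; exact Real.log_nonpos hu1.le (by linarith)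
  have hprod : (-Real.log u) * (-Real.log (1 - u)) ≤ (1 / u - 1) * (1 / (1 - u) - 1) :=
    mul_le_mul ha hb hb0 (by linarith)
  have hval : (1 / u - 1) * (1 / (1 - u) - 1) = 1 := by
    field_simp
    ring
  rw [neg_mul_neg, hval] at hprod
  exact hprod

/-- `Li₂(u) ≤ π²/6` for `0 ≤ u ≤ 1` (the series is dominated by `Σ 1/n²`). [folklore] -/
theorem reDilog_le {u : ℝ} (h0 : 0 ≤ u) (h1 : u ≤ 1) : reDilog u ≤ Real.pi ^ 2 / 6 := by
  rw [reDilog_eq_realDilog (abs_le.2 ⟨by linarith, h1⟩)]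
  have hz : HasSum (fun n : ℕ => 1 / ((n : ℝ) + 1) ^ 2) (Real.pi ^ 2 / 6) := by
    have h := hasSum_inv_succ_pow (k := 2) le_rfl
    rwa [show zetaValue 2 = Real.pi ^ 2 / 6 from hasSum_zeta_two.tsum_eq] at h
  refine hasSum_le (fun n => ?_) (hasSum_realDilog h0 h1) hz
  exact div_le_div_of_nonneg_right (pow_le_one₀ h0 h1) (by positivity)

/-- Two-sided bound `0 ≤ E(u) ≤ π²/6 + 1` on `(0,1)`. [folklore] -/
theorem Ek_le {u : ℝ} (h0 : 0 < u) (h1 : u < 1) :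
    reDilog u + Real.log u * Real.log (1 - u) ≤ Real.pi ^ 2 / 6 + 1 :=
  add_le_add (reDilog_le h0.le h1.le) (log_mul_log_one_sub_le_one h0 h1)

/-- `|log(1 − x)| ≤ 2|x|` for `|x| ≤ 1/2`. [folklore] -/
theorem abs_log_one_sub_le_two_mul {x : ℝ} (hx : |x| ≤ 1 / 2) : |Real.log (1 - x)| ≤ 2 * |x| := by
  have hx1 : |x| < 1 := by linarith
  have hb := Real.abs_log_sub_add_sum_range_le hx1 0
  simp only [Finset.range_zero, Finset.sum_empty, zero_add, pow_one] at hb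
  calc |Real.log (1 - x)| ≤ |x| / (1 - |x|) := hb
    _ ≤ |x| / (1 / 2) := div_le_div_of_nonneg_left (abs_nonneg x) (by norm_num) (by linarith)
    _ = 2 * |x| := by ring

/-- `E(u) → 0` as `u → 0⁺` (`Li₂(0) = 0` and `log u · log(1−u) → 0`). [folklore] -/
theorem tendsto_Ek_zero :
    Tendsto (fun u : ℝ => reDilog u + Real.log u * Real.log (1 - u)) (𝓝[>] 0) (𝓝 0) := by
  have h1 : Tendsto reDilog (𝓝 (0 : ℝ)) (𝓝 0) :=
    continuous_reDilog.tendsto' 0 0 Literature.Analysis.SpecialFunctions.reDilog_zero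
  have h2 : Tendsto (fun x : ℝ => Real.log x * Real.log (1 - x)) (𝓝 0) (𝓝 0) := by
    have hg : Tendsto (fun x : ℝ => 2 * ‖x * Real.log x‖) (𝓝 0) (𝓝 0) := by
      have h := (Real.continuous_mul_log.tendsto' (0 : ℝ) 0 (by simp)).norm.const_mul 2
      simpa using h
    refine squeeze_zero_norm' ?_ hg
    filter_upwards [eventually_abs_sub_lt (0 : ℝ) (by norm_num : (0 : ℝ) < 1 / 2)] with x hx
    rw [sub_zero] at hx
    rw [Real.norm_eq_abs, Real.norm_eq_abs, abs_mul, abs_mul]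
    calc |Real.log x| * |Real.log (1 - x)| ≤ |Real.log x| * (2 * |x|) :=
          mul_le_mul_of_nonneg_left (abs_log_one_sub_le_two_mul hx.le) (abs_nonneg _)
      _ = 2 * (|x| * |Real.log x|) := by ring
  have h := h1.add h2
  rw [add_zero] at h
  exact h.mono_left nhdsWithin_le_nhds

/-- For a function `g` with `g(u) → 0` as `u → 1⁻`, `g(u) · E(u)² → 0` (as `E` is bounded on `(0,1)`). [folklore] -/
theorem tendsto_mul_Ek_sq_one {g : ℝ → ℝ} (hg : Tendsto g (𝓝[<] 1) (𝓝 0)) :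
    Tendsto (fun u : ℝ => g u * (reDilog u + Real.log u * Real.log (1 - u)) ^ 2) (𝓝[<] 1) (𝓝 0) := by
  have hC : (0 : ℝ) ≤ (Real.pi ^ 2 / 6 + 1) ^ 2 := by positivity
  have hg' : Tendsto (fun u => ‖g u‖ * (Real.pi ^ 2 / 6 + 1) ^ 2) (𝓝[<] 1) (𝓝 0) := by
    have h := hg.norm.mul_const ((Real.pi ^ 2 / 6 + 1) ^ 2)
    simpa using h
  refine squeeze_zero_norm' ?_ hg'
  filter_upwards [Ioo_mem_nhdsLT (zero_lt_one' ℝ)] with u hu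
  rw [norm_mul, norm_pow, Real.norm_eq_abs, Real.norm_eq_abs, abs_of_nonneg (Ek_nonneg hu.1 hu.2)]
  exact mul_le_mul_of_nonneg_left (pow_le_pow_left₀ (Ek_nonneg hu.1 hu.2) (Ek_le hu.1 hu.2) 2) (abs_nonneg _)

/-- For a function `g` bounded near `0⁺`, `g(u) · E(u)² → 0` as `u → 0⁺`; stated for `g` continuous at `0`. [folklore] -/
theorem tendsto_mul_Ek_sq_zero {g : ℝ → ℝ} (hg : ContinuousAt g 0) :
    Tendsto (fun u : ℝ => g u * (reDilog u + Real.log u * Real.log (1 - u)) ^ 2) (𝓝[>] 0) (𝓝 0) := by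
  have h1 : Tendsto g (𝓝[>] 0) (𝓝 (g 0)) := hg.tendsto.mono_left nhdsWithin_le_nhds
  have h2 := (tendsto_Ek_zero).pow 2
  have h := h1.mul h2
  simpa using h

/-! ## 2. Integration by parts -/

/-- `uᵏ · E(u)²` is integrable on `(0,1)` (bounded and measurable). [folklore] -/
theorem integrableOn_pow_mul_Ek_sq (k : ℕ) :
    IntegrableOn (fun u : ℝ => u ^ k * (reDilog u + Real.log u * Real.log (1 - u)) ^ 2) (Ioo 0 1) := by
  have hmeas : AEStronglyMeasurable (fun u : ℝ => u ^ k * (reDilog u + Real.log u * Real.log (1 - u)) ^ 2)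
      (volume.restrict (Ioo (0:ℝ) 1)) := by
    have h : Continuous reDilog := continuous_reDilog
    exact (Measurable.aestronglyMeasurable (by fun_prop))
  refine ⟨hmeas, ?_⟩
  refine HasFiniteIntegral.restrict_of_bounded (μ := volume) ((Real.pi ^ 2 / 6 + 1) ^ 2) measure_Ioo_lt_top ?_
  refine (ae_restrict_mem measurableSet_Ioo).mono fun u hu => ?_
  rw [norm_mul, norm_pow, norm_pow, Real.norm_eq_abs, Real.norm_eq_abs, abs_of_nonneg hu.1.le,
    abs_of_nonneg (Ek_nonneg hu.1 hu.2)]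
  calc u ^ k * (reDilog u + Real.log u * Real.log (1 - u)) ^ 2
      ≤ 1 * (Real.pi ^ 2 / 6 + 1) ^ 2 :=
        mul_le_mul (pow_le_one₀ hu.1.le hu.2.le) (pow_le_pow_left₀ (Ek_nonneg hu.1 hu.2) (Ek_le hu.1 hu.2) 2)
          (by positivity) zero_le_one
    _ = (Real.pi ^ 2 / 6 + 1) ^ 2 := one_mul _

/-- **B6 = 2·B4** exactly: `∫₀¹ E(u)² du = 2 ∫₀¹ (−log u) E(u) du`, because
`d/du [(u − 1) E(u)²] = E(u)² − 2(−log u)E(u)` and `(u−1)E² → 0` at both ends of `(0,1)`. [folklore] -/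
theorem integral_Ek_sq_eq :
    ∫ u in Ioo (0:ℝ) 1, (reDilog u + Real.log u * Real.log (1 - u)) ^ 2 =
      2 * ∫ u in Ioo (0:ℝ) 1, (-Real.log u) * (reDilog u + Real.log u * Real.log (1 - u)) := by
  have hI1 : IntegrableOn (fun u : ℝ => (reDilog u + Real.log u * Real.log (1 - u)) ^ 2) (Ioo 0 1) := by
    have h := integrableOn_pow_mul_Ek_sq 0
    simpa using h
  have hI2 := integral_negLog_mul_Ek.1
  -- FTC on `(0,1)` for `F(u) = (u − 1) E(u)²`
  have hderiv : ∀ u ∈ Ioo (0:ℝ) 1, HasDerivAt (fun u : ℝ => (u - 1) * (reDilog u + Real.log u * Real.log (1 - u)) ^ 2)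
      ((reDilog u + Real.log u * Real.log (1 - u)) ^ 2 -
        2 * ((-Real.log u) * (reDilog u + Real.log u * Real.log (1 - u)))) u := by
    intro u hu
    have hE := hasDerivAt_Ek hu.1 hu.2
    have h := ((hasDerivAt_id' u).sub_const 1).fun_mul (hE.fun_pow 2)
    refine h.congr_deriv ?_
    have hu1 : 1 - u ≠ 0 := by intro h'; linarith [hu.2]
    norm_num
    field_simp
    ring
  have hint : IntervalIntegrable (fun u : ℝ => (reDilog u + Real.log u * Real.log (1 - u)) ^ 2 -
      2 * ((-Real.log u) * (reDilog u + Real.log u * Real.log (1 - u)))) volume 0 1 := by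
    rw [intervalIntegrable_iff_integrableOn_Ioo_of_le zero_le_one]
    exact hI1.sub (hI2.const_mul 2)
  have ha : Tendsto (fun u : ℝ => (u - 1) * (reDilog u + Real.log u * Real.log (1 - u)) ^ 2) (𝓝[>] 0) (𝓝 0) :=
    tendsto_mul_Ek_sq_zero (by fun_prop)
  have hb : Tendsto (fun u : ℝ => (u - 1) * (reDilog u + Real.log u * Real.log (1 - u)) ^ 2) (𝓝[<] 1) (𝓝 0) := by
    refine tendsto_mul_Ek_sq_one ?_
    have h : Tendsto (fun u : ℝ => u - 1) (𝓝 1) (𝓝 (1 - 1)) := tendsto_id.sub_const 1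
    rw [sub_self] at h
    exact h.mono_left nhdsWithin_le_nhds
  have hFTC := intervalIntegral.integral_eq_sub_of_hasDerivAt_of_tendsto zero_lt_one hderiv hint ha hb
  rw [sub_self, intervalIntegral.integral_of_le zero_le_one, integral_Ioc_eq_integral_Ioo,
    integral_sub hI1 (hI2.const_mul 2), MeasureTheory.integral_const_mul, sub_eq_zero] at hFTC
  exact hFTC

/-- **B6.** `∫₀¹ E(u)² du = 6 − 4ζ(3)`, with integrability. [folklore] -/
theorem integral_Ek_sq :
    IntegrableOn (fun u : ℝ => (reDilog u + Real.log u * Real.log (1 - u)) ^ 2) (Ioo 0 1) ∧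
      ∫ u in Ioo (0:ℝ) 1, (reDilog u + Real.log u * Real.log (1 - u)) ^ 2 = 6 - 4 * zetaValue 3 := by
  refine ⟨by simpa using integrableOn_pow_mul_Ek_sq 0, ?_⟩
  rw [integral_Ek_sq_eq, integral_negLog_mul_Ek.2]
  ring

/-- **B8 = B4 + B4'** exactly: `∫₀¹ u E(u)² du = ∫₀¹ (1 + u)(−log u) E(u) du`, because
`d/du [(u² − 1) E(u)²/2] = u E(u)² − (1 + u)(−log u)E(u)` and the boundary terms vanish. [folklore] -/
theorem integral_mul_Ek_sq_eq :
    ∫ u in Ioo (0:ℝ) 1, u * (reDilog u + Real.log u * Real.log (1 - u)) ^ 2 =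
      (∫ u in Ioo (0:ℝ) 1, (-Real.log u) * (reDilog u + Real.log u * Real.log (1 - u))) +
        ∫ u in Ioo (0:ℝ) 1, u * (-Real.log u) * (reDilog u + Real.log u * Real.log (1 - u)) := by
  have hI1 : IntegrableOn (fun u : ℝ => u * (reDilog u + Real.log u * Real.log (1 - u)) ^ 2) (Ioo 0 1) := by
    have h := integrableOn_pow_mul_Ek_sq 1
    simpa using h
  have hI2 := integral_negLog_mul_Ek.1
  have hI3 := integral_mul_negLog_mul_Ek.1
  have hI23 : IntegrableOn (fun u : ℝ => (-Real.log u) * (reDilog u + Real.log u * Real.log (1 - u)) +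
      u * (-Real.log u) * (reDilog u + Real.log u * Real.log (1 - u))) (Ioo 0 1) := hI2.add hI3
  have hderiv : ∀ u ∈ Ioo (0:ℝ) 1,
      HasDerivAt (fun u : ℝ => (u ^ 2 - 1) / 2 * (reDilog u + Real.log u * Real.log (1 - u)) ^ 2)
      (u * (reDilog u + Real.log u * Real.log (1 - u)) ^ 2 -
        ((-Real.log u) * (reDilog u + Real.log u * Real.log (1 - u)) +
          u * (-Real.log u) * (reDilog u + Real.log u * Real.log (1 - u)))) u := by
    intro u hu
    have hE := hasDerivAt_Ek hu.1 hu.2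
    have h := (((hasDerivAt_pow 2 u).sub_const 1).div_const 2).fun_mul (hE.fun_pow 2)
    refine h.congr_deriv ?_
    have hu1 : 1 - u ≠ 0 := by intro h'; linarith [hu.2]
    norm_num
    field_simp
    ring
  have hint : IntervalIntegrable (fun u : ℝ => u * (reDilog u + Real.log u * Real.log (1 - u)) ^ 2 -
      ((-Real.log u) * (reDilog u + Real.log u * Real.log (1 - u)) +
        u * (-Real.log u) * (reDilog u + Real.log u * Real.log (1 - u)))) volume 0 1 := by
    rw [intervalIntegrable_iff_integrableOn_Ioo_of_le zero_le_one]
    exact hI1.sub hI23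
  have ha : Tendsto (fun u : ℝ => (u ^ 2 - 1) / 2 * (reDilog u + Real.log u * Real.log (1 - u)) ^ 2)
      (𝓝[>] 0) (𝓝 0) := tendsto_mul_Ek_sq_zero (by fun_prop)
  have hb : Tendsto (fun u : ℝ => (u ^ 2 - 1) / 2 * (reDilog u + Real.log u * Real.log (1 - u)) ^ 2)
      (𝓝[<] 1) (𝓝 0) := by
    refine tendsto_mul_Ek_sq_one ?_
    have h : Tendsto (fun u : ℝ => (u ^ 2 - 1) / 2) (𝓝 1) (𝓝 ((1 ^ 2 - 1) / 2)) :=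
      ((tendsto_id.pow 2).sub_const 1).div_const 2
    rw [one_pow, sub_self, zero_div] at h
    exact h.mono_left nhdsWithin_le_nhds
  have hFTC := intervalIntegral.integral_eq_sub_of_hasDerivAt_of_tendsto zero_lt_one hderiv hint ha hb
  rw [sub_self, intervalIntegral.integral_of_le zero_le_one, integral_Ioc_eq_integral_Ioo,
    integral_sub hI1 hI23, integral_add hI2 hI3, sub_eq_zero] at hFTC
  exact hFTC

/-- **B8.** `∫₀¹ u E(u)² du = 71/16 − 3ζ(3)`, with integrability. [folklore] -/
theorem integral_mul_Ek_sq :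
    IntegrableOn (fun u : ℝ => u * (reDilog u + Real.log u * Real.log (1 - u)) ^ 2) (Ioo 0 1) ∧
      ∫ u in Ioo (0:ℝ) 1, u * (reDilog u + Real.log u * Real.log (1 - u)) ^ 2 = 71 / 16 - 3 * zetaValue 3 := by
  refine ⟨by simpa using integrableOn_pow_mul_Ek_sq 1, ?_⟩
  rw [integral_mul_Ek_sq_eq, integral_negLog_mul_Ek.2, integral_mul_negLog_mul_Ek.2]
  ring

end Summit.KontsevichZagierPeriods.Zeta5Search.EulerKernel
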